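import Summits.ABC.IUTFork.Joshi.TestATS2Reading
import Summits.ABC.IUTFork.Joshi.TestATS2QSideCensus
import Summits.ABC.IUTFork.Joshi.TestATS2QSideCensusGenuine
import Summits.ABC.IUTFork.Joshi.TestATS2QSideCensusGenuineJoshi
import HarnessLib

/-!
# Joshi [J-II]/[J-IIp] vs `S`, TEST part 4e — census row Y-10 for JOSHI'S OWN CONSTRUCTED READING `joshiReading`: `Y` is the region
# identification for every prototype datum / Ansatz lift datum (any model), and `¬ Y` at the genuine data under both q-normalisations

Proof-only Test file of the abc-iut cell, block E, D-0079 R-J «JOSHI Y-DISCHARGE CENSUS» row **Y-10** (seat abc-iut-E-t2, gen 8; rung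
LADDER-ABC:A2.RESCUE.J); corollary file of `Joshi/TestATS2QSideCensus.lean` (p453563, `Y` LOCATED container-free) and of
`Joshi/TestATS2QSideCensusGenuine.lean` / `…GenuineJoshi.lean` (p453568 / p453575, `¬ Y` at the genuine data, pin-free cores), SPECIALISED
to the reading `joshiReading` that abc-iut-E-t2's `Joshi/TestATS2Reading.lean` BUILDS from Joshi's typed construction (abc-iut-E-t3's
carrier `PrototypeDatum`, [J-IIp] Def. 6.2.3 / Thm. 6.9.1 / Prop. 7.4.2–7.4.4; Joshi's (J) «Θ-pilot object appears» is PROVED for it,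
`joshiReading_thetaPilotAppears`). This answers the census's row text «prover: QSide at (confluent-)column genuine model» BY NAME: the
statements below quantify over EVERY `PrototypeDatum` — hence over every model of Joshi's period-ring / log-link signature that feeds one
(p434703 / p435174 / p439129 lineages) — and the answer does not depend on it. **No side is taken** on [IUTchIII] Cor. 3.12 or on any
author; typed ≠ proved ≠ endorsed. PROOF-ONLY: 0 definitions, no `Prop` fact, no `sorry`, standard axioms.

## RESULTS (kernel)
* `joshiReading_qSide_iff_regionId` — for every `Pd`, `L`, `ρ₀ ∈ (0,1]`, binding `reg` with δ1 ∧ δ2: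
  `(joshiReading L hl ρ₀ reg).QSide ρ qK ↔ ∀ j v_ℚ, ρ qK j v_ℚ = ρ Ψ_n j v_ℚ` (= B3's H_J21-1, `joshiReading_qSide_iff_joshiAnsatzQReading`).
* `joshiReading_qSide_iff_joshiReading_qSide` — two Joshi readings built from DIFFERENT prototype data / lifts / radii / bindings (two
  models) AGREE on `Y`: the model cancels.
* `joshiReading_no_qSide_genuine_printNormalised` / `joshiReading_no_qSide_genuine_joshiNormalised` — at abc-iut-c312-7's
  `settingPrVolSharp` with realising ideles (print's `htq` at label `2` / Joshi's `htqJ` at label `1`), for every column datum, every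
  honest one-packet `ρ`/`qK`, every `Pd`/`L`/`ρ₀`/`reg` with δ1 ∧ δ2: `¬ Y` for `joshiReading`.
[claim: Joshi2023ATS2Local, status: disputed] [claim: Joshi2021ATS2, status: disputed] [claim: Mochizuki2012, status: disputed]
[cite: ScholzeStix2018, §2.2 pp. 9–10]
-/

noncomputable section

open Set

namespace Summit.ABC.IUTFork.Joshi.ATS2

open Thm311 Cor312 Cor312Vol Literature.IUT.LogThetaLattice

/-! ## 1. Interface level: `Y` for Joshi's constructed reading is the region identification, whatever the prototype datum -/

section Interface

variable {F' B' E0 : Type} [Field F'] [CommRing B'] [Field E0] {Y' : Type} {K' : Y' → Type} [∀ y, Field (K' y)] {G' : Type}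
  {T : ThetaIndex} {S : LatticeSituation T} (P : Cor312.Setting S.toSituation)
  (ρ : (∀ v : T.V, v ∈ T.Vbad → Set (S.L.StarPacket v)) → ∀ (j : T.Label) (vQ : T.VQ), Set (S.L.Packet j vQ))
  (qK : ∀ v : T.V, v ∈ T.Vbad → Set (S.L.StarPacket v))

/-- **`Y` for `joshiReading` ⟺ the region identification**, for EVERY prototype datum `Pd`, Ansatz lifts `L`, radius `ρ₀ ∈ (0,1]` and
binding `reg` with δ1 ∧ δ2 ((J) is a theorem for this reading). [claim: Joshi2023ATS2Local, status: disputed] -/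
theorem joshiReading_qSide_iff_regionId {Pd : PrototypeDatum F' B' E0 Y' K' G'} (L : AnsatzLifts Pd) (hl : Pd.lstar = T.lstar)
    {ρ₀ : ℝ} (hρ : 0 < ρ₀) (hρ1 : ρ₀ ≤ 1) (reg : ∀ (j : T.Label) (vQ : T.VQ), B' → Set (S.L.Packet j vQ))
    (h1 : (joshiReading L hl ρ₀ reg : PilotReading S B').SizeDetermines) (h2 : (joshiReading L hl ρ₀ reg).ThetaSide P ρ) :
    (joshiReading L hl ρ₀ reg : PilotReading S B').QSide ρ qK ↔ ∀ (j : T.Label) (vQ : T.VQ), ρ qK j vQ = ρ (S.D P.n).Ψ j vQ :=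
  (joshiReading L hl ρ₀ reg).qSide_iff_regionId P ρ qK h1 h2 (joshiReading_thetaPilotAppears L hl hρ hρ1 reg)

/-- … ⟺ sub-cell B3's H_J21-1 `Repair.JoshiAnsatzQReading`. [claim: Joshi2023ATS2Local, status: disputed] -/
theorem joshiReading_qSide_iff_joshiAnsatzQReading {Pd : PrototypeDatum F' B' E0 Y' K' G'} (L : AnsatzLifts Pd)
    (hl : Pd.lstar = T.lstar) {ρ₀ : ℝ} (hρ : 0 < ρ₀) (hρ1 : ρ₀ ≤ 1) (reg : ∀ (j : T.Label) (vQ : T.VQ), B' → Set (S.L.Packet j vQ))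
    (h1 : (joshiReading L hl ρ₀ reg : PilotReading S B').SizeDetermines) (h2 : (joshiReading L hl ρ₀ reg).ThetaSide P ρ) :
    (joshiReading L hl ρ₀ reg : PilotReading S B').QSide ρ qK ↔ Repair.JoshiAnsatzQReading S P ρ qK :=
  joshiReading_qSide_iff_regionId P ρ qK L hl hρ hρ1 reg h1 h2

/-- **The model cancels**: two Joshi readings built from two prototype data (two instantiations / models of the carrier), two lift data,
two radii and two bindings, each with δ1 ∧ δ2, AGREE on `Y`. [claim: Joshi2023ATS2Local, status: disputed] -/
theorem joshiReading_qSide_iff_joshiReading_qSide {F'' B'' E0' : Type} [Field F''] [CommRing B''] [Field E0'] {Y'' : Type}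
    {K'' : Y'' → Type} [∀ y, Field (K'' y)] {G'' : Type} {Pd : PrototypeDatum F' B' E0 Y' K' G'}
    {Pd' : PrototypeDatum F'' B'' E0' Y'' K'' G''} (L : AnsatzLifts Pd) (L' : AnsatzLifts Pd') (hl : Pd.lstar = T.lstar)
    (hl' : Pd'.lstar = T.lstar) {ρ₀ ρ₀' : ℝ} (hρ : 0 < ρ₀) (hρ1 : ρ₀ ≤ 1) (hρ' : 0 < ρ₀') (hρ1' : ρ₀' ≤ 1)
    (reg : ∀ (j : T.Label) (vQ : T.VQ), B' → Set (S.L.Packet j vQ))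
    (reg' : ∀ (j : T.Label) (vQ : T.VQ), B'' → Set (S.L.Packet j vQ))
    (h1 : (joshiReading L hl ρ₀ reg : PilotReading S B').SizeDetermines) (h2 : (joshiReading L hl ρ₀ reg).ThetaSide P ρ)
    (h1' : (joshiReading L' hl' ρ₀' reg' : PilotReading S B'').SizeDetermines)
    (h2' : (joshiReading L' hl' ρ₀' reg').ThetaSide P ρ) :
    (joshiReading L hl ρ₀ reg : PilotReading S B').QSide ρ qK ↔ (joshiReading L' hl' ρ₀' reg' : PilotReading S B'').QSide ρ qK :=
  (joshiReading L hl ρ₀ reg).qSide_iff_qSide P ρ qK (joshiReading L' hl' ρ₀' reg') h1 h2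
    (joshiReading_thetaPilotAppears L hl hρ hρ1 reg) h1' h2' (joshiReading_thetaPilotAppears L' hl' hρ' hρ1' reg')

end Interface

/-! ## 2. At the genuine data (both q-normalisations): `¬ Y` for Joshi's constructed reading, whatever the prototype datum -/


open Function NumberField IsDedekindDomain
open Thm311 Thm311.Real Cor312 Cor312Vol Literature.IUT.LogThetaLattice Literature.IUT.LogVolume Literature.IUT.HodgeTheaters

section Genuine

variable {F : Type} [Field F] [NumberField F] (X : PilotData F) {logv : PadicLogs F} (hlog : LogvAnalytic logv)
  (M : Type) [Field M] [NumberField M]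
  (archPk : ∀ (j : (thetaIndex X).Label) (vQ : (thetaIndex X).VQ), Set ((logShellsDH X logv).Packet j vQ))
  (archSub : ∀ (j : (thetaIndex X).Label) (v : (thetaIndex X).V),
    Set ((logShellsDH X logv).Packet j ((thetaIndex X).over v)))
  (Ψ : ℤ → ∀ v : (thetaIndex X).V, v ∈ (thetaIndex X).Vbad → Set ((logShellsDH X logv).StarPacket v))
  (act : ℤ → ∀ v : (thetaIndex X).V, v ∈ (thetaIndex X).Vbad →
    (logShellsDH X logv).StarPacket v → Module.End ℚ ((logShellsDH X logv).StarPacket v))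
  (Mmod : ℤ → ∀ j : (thetaIndex X).LabelStar, Set ((logShellsDH X logv).GlobalPacket j.1))
  (region : ℤ → ∀ j : (thetaIndex X).LabelStar, FinDivisor M → ∀ vQ : (thetaIndex X).VQ,
    Set ((logShellsDH X logv).Packet j.1 vQ))
  (n : ℤ) {HT : Type} {LogLink : HT → HT → Type} {IsFull : ∀ {s t : HT}, LogLink s t → Prop}
  (lat : LGPGaussianLogThetaLattice LogLink IsFull)
  {Frd : Type} {IsoF : Frd → Frd → Type} {Ob : Frd → Type} {realify : Frd → Frd} {Strip : Type}
  {IsoS : Strip → Strip → Type} {Mv : ∀ v : (thetaIndex X).V, v ∈ (thetaIndex X).Vbad → Type}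
  [∀ v h, Monoid (Mv v h)]
  (sig : GlobalLGPFrobenioidSignature (thetaIndex X).lstar (thetaIndex X).V (· ∈ (thetaIndex X).Vbad)
    Frd IsoF Ob realify Strip IsoS Mv)
  (split : SplittingMonoids Mv) {ObΔ : Type} {N : ∀ v : (thetaIndex X).V, v ∈ (thetaIndex X).Vbad → Type}
  [∀ v h, Monoid (N v h)] (qData : QPilotData ObΔ N)
  (t : ∀ (pp : Nat.Primes) (_ : Fin X.lstar) (x : (thetaIndex X).Fibre (.inr pp)),
    haveI : Fact (pp : ℕ).Prime := ⟨pp.2⟩; kOf X pp.1 x)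
  (tq : ∀ (pp : Nat.Primes) (x : (thetaIndex X).Fibre (.inr pp)), haveI : Fact (pp : ℕ).Prime := ⟨pp.2⟩; kOf X pp.1 x)
  (ρ : (∀ v : (thetaIndex X).V, v ∈ (thetaIndex X).Vbad → Set ((logShellsDH X logv).StarPacket v)) →
    ∀ (j : (thetaIndex X).Label) (vQ : (thetaIndex X).VQ), Set ((logShellsDH X logv).Packet j vQ))
  (qK : ∀ v : (thetaIndex X).V, v ∈ (thetaIndex X).Vbad → Set ((logShellsDH X logv).StarPacket v))
  {F' B' E0 : Type} [Field F'] [CommRing B'] [Field E0] {Y' : Type} {K' : Y' → Type} [∀ y, Field (K' y)] {G' : Type}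

/-- **`¬ Y` for JOSHI'S OWN CONSTRUCTED READING at the genuine data (print's q-normalisation, label `2`).** For EVERY prototype datum `Pd` of abc-iut-E-t3's
carrier (any instantiation — in particular any period-ring / log-link column MODEL feeding it), every Ansatz lift datum `L`, every
`ρ₀ ∈ (0, 1]`, every binding `reg` of Joshi's container to OUR packets with δ1 ∧ δ2, every column datum, and every `ρ`, `qK` with the two
one-packet identifications: the reading `joshiReading L hl ρ₀ reg` VIOLATES `Y` — (J) being PROVED for it, the companion's
`no_qSide_genuine_printNormalised` applies. [claim: Joshi2023ATS2Local, status: disputed] [claim: Joshi2021ATS2, status: disputed] -/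
theorem joshiReading_no_qSide_genuine_printNormalised (ht0 : ∀ pp i x, t pp i x ≠ 0)
    (ht : ∀ (pp : Nat.Primes) (i : Fin X.lstar) (x : (thetaIndex X).Fibre (.inr pp)),
      haveI : Fact (pp : ℕ).Prime := ⟨pp.2⟩
      Real.log ‖t pp i x‖ = -(X.thetaPilot i (placeOf X pp.1 x)) * logNorm F (placeOf X pp.1 x) /
        localDegree F (placeOf X pp.1 x))
    (htq0 : ∀ pp x, tq pp x ≠ 0)
    (htq1 : ∀ (pp : Nat.Primes) (x : (thetaIndex X).Fibre (.inr pp)),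
      haveI : Fact (pp : ℕ).Prime := ⟨pp.2⟩; placeOf X pp.1 x ∉ X.S → ‖tq pp x‖ = 1)
    (htq : ∀ (pp : Nat.Primes) (x : (thetaIndex X).Fibre (.inr pp)),
      haveI : Fact (pp : ℕ).Prime := ⟨pp.2⟩
      Real.log ‖tq pp x‖ = -(X.qPilot (placeOf X pp.1 x)) * logNorm F (placeOf X pp.1 x) /
        localDegree F (placeOf X pp.1 x))
    {v₀ : HeightOneSpectrum (𝓞 F)} (hv₀ : v₀ ∈ X.S) (pp : Nat.Primes)
    (hp : haveI : Fact (pp : ℕ).Prime := ⟨pp.2⟩; v₀ ∈ placesOver F pp) (col : ℤ → Column (logShellsDH X logv))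
    (hq : ρ qK (Setting.labelSucc ⟨1, X.two_le_lstar⟩) (.inr pp) = (settingPrVolSharp X hlog M archPk archSub Ψ act Mmod region n lat sig split qData tq t htq0 htq1).qRegion (Setting.labelSucc ⟨1, X.two_le_lstar⟩) (.inr pp))
    (hθ : ∃ m : ℤ, ρ (Ψ n) (Setting.labelSucc ⟨1, X.two_le_lstar⟩) (.inr pp) =
      (settingPrVolSharp X hlog M archPk archSub Ψ act Mmod region n lat sig split qData tq t htq0 htq1).thetaRegion m (Setting.labelSucc ⟨1, X.two_le_lstar⟩) (.inr pp))
    {Pd : PrototypeDatum F' B' E0 Y' K' G'} (L : AnsatzLifts Pd) (hl : Pd.lstar = (thetaIndex X).lstar) {ρ₀ : ℝ} (hρ : 0 < ρ₀)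
    (hρ1 : ρ₀ ≤ 1)
    (reg : ∀ (j : (thetaIndex X).Label) (vQ : (thetaIndex X).VQ), B' → Set ((logShellsDH X logv).Packet j vQ))
    (h1 : (joshiReading L hl ρ₀ reg : PilotReading (LatticeSituation.mk (situationPrVol X hlog M archPk archSub Ψ act Mmod region) col) B').SizeDetermines)
    (h2 : (joshiReading L hl ρ₀ reg : PilotReading (LatticeSituation.mk (situationPrVol X hlog M archPk archSub Ψ act Mmod region) col) B').ThetaSide
      (settingPrVolSharp X hlog M archPk archSub Ψ act Mmod region n lat sig split qData tq t htq0 htq1) ρ) :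
    ¬ (joshiReading L hl ρ₀ reg : PilotReading (LatticeSituation.mk (situationPrVol X hlog M archPk archSub Ψ act Mmod region) col) B').QSide ρ qK :=
  no_qSide_genuine_printNormalised X hlog M archPk archSub Ψ act Mmod region n lat sig split qData t tq ρ qK ht0 ht htq0 htq1 htq hv₀ pp
    hp col hq hθ _ h1 h2
    (joshiReading_thetaPilotAppears
      (S := LatticeSituation.mk (situationPrVol X hlog M archPk archSub Ψ act Mmod region) col) L hl hρ hρ1 reg)

/-- **`¬ Y` for JOSHI'S OWN CONSTRUCTED READING at the genuine data (Joshi's q-normalisation, label `1`).** For EVERY prototype datum `Pd` of abc-iut-E-t3's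
carrier (any instantiation — in particular any period-ring / log-link column MODEL feeding it), every Ansatz lift datum `L`, every
`ρ₀ ∈ (0, 1]`, every binding `reg` of Joshi's container to OUR packets with δ1 ∧ δ2, every column datum, and every `ρ`, `qK` with the two
one-packet identifications: the reading `joshiReading L hl ρ₀ reg` VIOLATES `Y` — (J) being PROVED for it, the companion's
`no_qSide_genuine_joshiNormalised` applies. [claim: Joshi2023ATS2Local, status: disputed] [claim: Joshi2021ATS2, status: disputed] -/
theorem joshiReading_no_qSide_genuine_joshiNormalised (ht0 : ∀ pp i x, t pp i x ≠ 0)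
    (ht : ∀ (pp : Nat.Primes) (i : Fin X.lstar) (x : (thetaIndex X).Fibre (.inr pp)),
      haveI : Fact (pp : ℕ).Prime := ⟨pp.2⟩
      Real.log ‖t pp i x‖ = -(X.thetaPilot i (placeOf X pp.1 x)) * logNorm F (placeOf X pp.1 x) /
        localDegree F (placeOf X pp.1 x))
    (htq0 : ∀ pp x, tq pp x ≠ 0)
    (htq1 : ∀ (pp : Nat.Primes) (x : (thetaIndex X).Fibre (.inr pp)),
      haveI : Fact (pp : ℕ).Prime := ⟨pp.2⟩; placeOf X pp.1 x ∉ X.S → ‖tq pp x‖ = 1)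
    (htqJ : ∀ (pp : Nat.Primes) (x : (thetaIndex X).Fibre (.inr pp)),
      haveI : Fact (pp : ℕ).Prime := ⟨pp.2⟩
      Real.log ‖tq pp x‖ = -(((X.lstar : ℝ) ^ 2) * X.qPilot (placeOf X pp.1 x)) * logNorm F (placeOf X pp.1 x) /
        localDegree F (placeOf X pp.1 x))
    {v₀ : HeightOneSpectrum (𝓞 F)} (hv₀ : v₀ ∈ X.S) (pp : Nat.Primes)
    (hp : haveI : Fact (pp : ℕ).Prime := ⟨pp.2⟩; v₀ ∈ placesOver F pp) (col : ℤ → Column (logShellsDH X logv))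
    (hq : ρ qK (Setting.labelSucc ⟨0, lt_of_lt_of_le two_pos X.two_le_lstar⟩) (.inr pp) = (settingPrVolSharp X hlog M archPk archSub Ψ act Mmod region n lat sig split qData tq t htq0 htq1).qRegion (Setting.labelSucc ⟨0, lt_of_lt_of_le two_pos X.two_le_lstar⟩) (.inr pp))
    (hθ : ∃ m : ℤ, ρ (Ψ n) (Setting.labelSucc ⟨0, lt_of_lt_of_le two_pos X.two_le_lstar⟩) (.inr pp) =
      (settingPrVolSharp X hlog M archPk archSub Ψ act Mmod region n lat sig split qData tq t htq0 htq1).thetaRegion m (Setting.labelSucc ⟨0, lt_of_lt_of_le two_pos X.two_le_lstar⟩) (.inr pp))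
    {Pd : PrototypeDatum F' B' E0 Y' K' G'} (L : AnsatzLifts Pd) (hl : Pd.lstar = (thetaIndex X).lstar) {ρ₀ : ℝ} (hρ : 0 < ρ₀)
    (hρ1 : ρ₀ ≤ 1)
    (reg : ∀ (j : (thetaIndex X).Label) (vQ : (thetaIndex X).VQ), B' → Set ((logShellsDH X logv).Packet j vQ))
    (h1 : (joshiReading L hl ρ₀ reg : PilotReading (LatticeSituation.mk (situationPrVol X hlog M archPk archSub Ψ act Mmod region) col) B').SizeDetermines)
    (h2 : (joshiReading L hl ρ₀ reg : PilotReading (LatticeSituation.mk (situationPrVol X hlog M archPk archSub Ψ act Mmod region) col) B').ThetaSide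
      (settingPrVolSharp X hlog M archPk archSub Ψ act Mmod region n lat sig split qData tq t htq0 htq1) ρ) :
    ¬ (joshiReading L hl ρ₀ reg : PilotReading (LatticeSituation.mk (situationPrVol X hlog M archPk archSub Ψ act Mmod region) col) B').QSide ρ qK :=
  no_qSide_genuine_joshiNormalised X hlog M archPk archSub Ψ act Mmod region n lat sig split qData t tq ρ qK ht0 ht htq0 htq1 htqJ hv₀ pp
    hp col hq hθ _ h1 h2
    (joshiReading_thetaPilotAppears
      (S := LatticeSituation.mk (situationPrVol X hlog M archPk archSub Ψ act Mmod region) col) L hl hρ hρ1 reg)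

end Genuine

end Summit.ABC.IUTFork.Joshi.ATS2

end
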